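import Summits.Ventures.HodgeRepro2.T5SU11SphericalODE

/-!
# The first non-trivial spherical function of `SU(1,1)` in closed form:
`φ_{-2} = φ_4`, `φ_4(a_t) = cosh 2t`, `φ_4(g) = 2|a(g)|² − 1 = |a(g)|² + |b(g)|²`

Laplace's integral `sph λ (a_t) = (2π)⁻¹ ∫_{-π}^{π} (cosh 2t − sinh 2t cos φ)^{-λ/2} dφ` is elementary at
`λ = -2` (exponent `1`): `∫ cos φ dφ = 0` over a period, so **`sph (-2) (a_t) = cosh 2t`**
(`sph_neg_two_hyp`) and, by the functional equation `φ_λ = φ_{2-λ}`, **`sph 4 (a_t) = cosh 2t`**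
(`sph_four_hyp`) — the Legendre function `P_1(cosh 2t)` of Laplace's integral `P_n(z) = (1/π) ∫_0^π
(z + √(z² − 1) cos φ)^n dφ` at `n = 1`. On the group, with `cosh (cartanT g) = |a(g)|` and
`|a(g)|² − |b(g)|² = 1`: **`sph 4 g = 2|a(g)|² − 1 = |a(g)|² + |b(g)|²`** (`sph_four`, `sph_four_eq_add`,
`sph_neg_two`), a quadratic polynomial in the matrix entries — the first instance of the spherical
functions of even negative parameter being polynomial in `g` (the `K`-invariant matrix coefficients of
the finite-dimensional representations of `SU(1,1)`). Nothing is claimed about (N).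

Blind lane: Mathlib + the HodgeRepro2 prefix only; no sorry; axioms ⊆ {propext, Classical.choice,
Quot.sound}.
-/

namespace Summit.Ventures.HodgeRepro2.T5SU11SphericalLegendre

open MeasureTheory Metric Set Filter Topology Complex intervalIntegral
open T5SU11Unimodular T5SU11Fibration T5SU11Cartan T5SU11OneParameter T5SU11CartanProjection
  T5HaarCircle T5BergmanCoefficient T5SU11SphericalFunction T5SU11SphericalTwo
  T5SU11SphericalSymmetry T5SU11SphericalBounds T5SU11SphericalContinuous
  T5SU11SphericalAsymptotic T5SU11SphericalLp T5SU11SphericalCfun T5SU11SphericalLpSharp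
  T5SU11SphericalXiLog T5SU11SphericalCfunLimit T5SU11SphericalStrict T5SU11SphericalDeriv
  T5SU11SphericalODE
open scoped Real

/-- `∫_{-π}^{π} (cosh 2t − sinh 2t cos φ) dφ = 2π cosh 2t`. -/
lemma integral_laplace_base (t : ℝ) :
    ∫ φ in (-π)..π, (Real.cosh (2 * t) - Real.sinh (2 * t) * Real.cos φ) = 2 * π * Real.cosh (2 * t) := by
  rw [integral_sub intervalIntegrable_const (Real.continuous_cos.intervalIntegrable _ _ |>.const_mul _),
    intervalIntegral.integral_const_mul, integral_cos, intervalIntegral.integral_const, Real.sin_pi,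
    Real.sin_neg, Real.sin_pi, smul_eq_mul]
  ring

section measure

variable [MeasurableSpace Circle] [BorelSpace Circle]

/-- **`sph (-2) (a_t) = cosh 2t`.** -/
theorem sph_neg_two_hyp (t : ℝ) : sph (-2) (hyp t) = Real.cosh (2 * t) := by
  rw [sph_hyp_eq_laplace]
  have e : (fun φ => (Real.cosh (2 * t) - Real.sinh (2 * t) * Real.cos φ) ^ (-(-2 : ℝ) / 2)) =
      fun φ => Real.cosh (2 * t) - Real.sinh (2 * t) * Real.cos φ := by
    funext φ
    rw [show (-(-2 : ℝ) / 2) = 1 by norm_num, Real.rpow_one]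
  rw [e, integral_laplace_base]
  have hπ := Real.pi_pos
  rw [show (2 * π)⁻¹ * (2 * π * Real.cosh (2 * t)) = Real.cosh (2 * t) * ((2 * π)⁻¹ * (2 * π)) by ring,
    inv_mul_cancel₀ (by positivity), mul_one]

/-- **`sph 4 (a_t) = cosh 2t`** (the functional equation `φ_4 = φ_{-2}`). -/
theorem sph_four_hyp (t : ℝ) : sph 4 (hyp t) = Real.cosh (2 * t) := by
  rw [sph_two_sub_hyp, show (2 : ℝ) - 4 = -2 by norm_num, sph_neg_two_hyp]

/-- **`sph (-2) g = 2 |a(g)|² − 1`.** -/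
theorem sph_neg_two (g : SU11) : sph (-2) g = 2 * ‖mat g 0 0‖ ^ 2 - 1 := by
  rw [sph_eq_sph_hyp_cartanT, sph_neg_two_hyp, ← cosh_cartanT, Real.cosh_two_mul, Real.cosh_sq]
  ring

/-- **`sph 4 g = 2 |a(g)|² − 1`.** -/
theorem sph_four (g : SU11) : sph 4 g = 2 * ‖mat g 0 0‖ ^ 2 - 1 := by
  rw [sph_two_sub 4 g, show (2 : ℝ) - 4 = -2 by norm_num, sph_neg_two]

/-- **`sph 4 g = |a(g)|² + |b(g)|²`** (`|a|² − |b|² = 1` on `SU(1,1)`). -/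
theorem sph_four_eq_add (g : SU11) : sph 4 g = ‖mat g 0 0‖ ^ 2 + ‖mat g 0 1‖ ^ 2 := by
  have h := normSq_sub_normSq g
  rw [Complex.normSq_eq_norm_sq, Complex.normSq_eq_norm_sq] at h
  rw [sph_four]
  linarith

/-- `sph 4 g ≥ 1`, with equality exactly on `K` (`|b(g)| = 0`). -/
theorem one_le_sph_four (g : SU11) : 1 ≤ sph 4 g := by
  rw [sph_four_eq_add]
  have h := normSq_sub_normSq g
  rw [Complex.normSq_eq_norm_sq, Complex.normSq_eq_norm_sq] at h
  nlinarith [sq_nonneg ‖mat g 0 1‖]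

end measure

end Summit.Ventures.HodgeRepro2.T5SU11SphericalLegendre
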